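import Literature.ModelTheory.ExponentialFields.RealExpDecidableOfLastRoot
import Literature.ModelTheory.ExponentialFields.KhovanskiiZeroBound
import HarnessLib

/-!
# Decidability of `Th(ℝ_exp)` ⇒ Last Root Conjecture, unconditionally; the equivalence from effective model completeness alone

Topic `Literature/ModelTheory/ExponentialFields`, sequel to `LastRootConjectureOfDecidable.lean`
and `RealExpDecidableOfLastRoot.lean`, towards the named fact
`Literature.ModelTheory.ExponentialFields.macintyreWilkie_realExpDecidable_iff_lastRootConjecture`
(`RealExpDecidable ↔ LastRootConjecture`; Macintyre–Wilkie 1996, as reported by Berarducci–Servi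
2004, p. 44: "the authors show that the decidability is equivalent to a weaker conjecture, the
Last Root Conjecture").

`LastRootConjectureOfDecidable.lean` proves the direction `→` *granted Wilkie's o-minimality
theorem* (`lastRootConjecture_of_realExpDecidable (hO : wilkie_isOMinimal)`): o-minimality is used
there at exactly one point, to know that the non-singular zeros of an `n × n` system of exponential
polynomials over `ℤ` form a **bounded** subset of `ℝⁿ` (`ExpPolyCode.exists_bound_isNonsingularZero`,
`LastRootConjectureProofs.lean`: they are isolated, hence countable, and a countable definable
subset of the line is bounded in an o-minimal expansion of `ℝ`), so that the search for a true
bounding sentence `σ_{F,η}` terminates.  Berarducci–Servi (2004, p. 44, the remark after the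
statement of the conjecture) point out that the existence of such a bound is immediate from
**Khovanskii's finiteness theorem**: an `n × n` system has only finitely many non-singular zeros.
Khovanskii's theorem for square systems of `L_exp`-terms is now **proved** in the tree
(`RealExpModel.exists_forall_encard_realNonsingularZeroSet_le`, `KhovanskiiZeroBound.lean`,
resting on the proved Tarski–Seidenberg theorem), and this file draws the consequence:

* `ExpPolyCode.finite_setOf_isNonsingularZero`: the non-singular zeros of an `n × n` system of
  exponential polynomials over `ℤ` (`ExpPolyCode.IsNonsingularZero`) form a finite set — the rows
  of the system are the `L_exp`-terms `ExpPolyCode.rowTerm` of `LastRootConjectureProofs.lean`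
  (parameters renamed from `Empty` to `Fin 0`), whose gradient rows (`RealExpModel.grad`, Wilkie's
  formal partial derivatives) form the Jacobian matrix `ExpPolyCode.jac`
  (`ExpPolyCode.of_grad_rowTerm_relabel`), so that the non-singular zeros lie in Wilkie's `Vⁿˢ`
  (`ExpPolyCode.setOf_isNonsingularZero_subset_realNonsingularZeroSet`);
* `ExpPolyCode.exists_bound_isNonsingularZero'`, `ExpPolyCode.exists_realize_sigma'`: hence a
  bound `η ∈ ℕ` on their sup norm and a true bounding sentence `σ_{F,η}`, with no hypothesis;
* `ExpPolyCode.exists_computable_bound_of_isDecidable'` and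
  **`lastRootConjecture_of_realExpDecidable'  : RealExpDecidable → LastRootConjecture`** — the
  direction `→` of Macintyre–Wilkie's equivalence, now **unconditional** (the search of
  `LastRootConjectureOfDecidable.lean` verbatim, fed with `exists_realize_sigma'`);
* `lastRootConjecture_of_macintyre_wilkie` : Macintyre–Wilkie's Thm. 1.1
  (`Literature.ModelTheory.ExponentialFields.macintyre_wilkie`) and the real Schanuel property give
  the Last Root Conjecture, without o-minimality;
* **`macintyreWilkie_realExpDecidable_iff_lastRootConjecture_of_recursiveSubtheory`**: the named
  equivalence follows from Macintyre–Wilkie's effective model completeness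
  `macintyreWilkie_recursiveSubtheory` (A0) **alone** (the direction `←` being
  `realExpDecidable_of_lastRootConjecture_of_recursiveSubtheory` of
  `RealExpDecidableOfLastRoot.lean`, which proved unconditionally that the Last Root Conjecture
  makes `Th_∃(ℝ_exp)` recursively enumerable), superseding
  `macintyreWilkie_realExpDecidable_iff_lastRootConjecture_of_facts (hO) (hA)`;
* `macintyreWilkie_realExpDecidable_iff_lastRootConjecture_iff`: indeed the named fact is now
  **equivalent** to the implication `LastRootConjecture → macintyreWilkie_recursiveSubtheory`
  (a decidable `Th(ℝ_exp)` is its own recursive subtheory), which locates exactly what remains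
  to be proved of it: effective model completeness, i.e. the unconditional half of
  Macintyre–Wilkie's paper.

No definition and no named fact is introduced; the file is sorry-free.

## References

* A. Macintyre, A. J. Wilkie, *On the decidability of the real exponential field*, in:
  Kreiseliana: About and Around Georg Kreisel, A K Peters (1996), 441–467.
* A. Berarducci, T. Servi, *An effective version of Wilkie's theorem of the complement and some
  effective o-minimality results*, Ann. Pure Appl. Logic 125 (2004), 43–74, p. 44 (the Last Root
  Conjecture; "by Khovanskii's finiteness theorem such a bound exists").
* A. G. Khovanskii, *Fewnomials*, Transl. Math. Monogr. 88, AMS (1991), Ch. III.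
* A. J. Wilkie, *On the theory of the real exponential field*, Illinois J. Math. 33 (1989), §1,
  p. 385 (formal partial derivatives) and §5, Proposition (p. 402).
-/

noncomputable section

open FirstOrder FirstOrder.Language

namespace Literature.ModelTheory.ExponentialFields

namespace ExpPolyCode

open RealExpModel Encodable

/-! ### The rows of a system in the format of Wilkie's `Vⁿˢ` -/

section Rows

variable (n : ℕ) (F : List ExpPolyCode)

/-- The row terms of the system (`rowTerm`, terms of `L_exp` in the coordinate variables with
the empty type `Empty` of parameters), with parameters renamed to the empty tuple `Fin 0` (the
format of Wilkie's `Vⁿˢ`, `RealExpModel.realNonsingularZeroSet`), realize to the rows of the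
system. [folklore] -/
theorem realize_rowTerm_relabel (β : Fin 0 → ℝ) (x : Fin n → ℝ) (i : Fin n) :
    ((rowTerm n F i).relabel (Sum.map Empty.elim _root_.id)).realize (Sum.elim β x) =
      eval n (F.getD (i : ℕ) []) x := by
  simp only [Term.realize_relabel, Sum.elim_comp_map, Function.comp_id, realize_rowTerm]

/-- **The gradient rows of the row terms form the Jacobian matrix** `jac` of
`LastRootConjectureProofs.lean` (Wilkie's formal partial derivatives commute with the renaming
of parameters, `RealExpModel.realize_termPDeriv_relabel_params'`). [cite: Wilkie1989, §1, p. 385] -/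
theorem of_grad_rowTerm_relabel (β : Fin 0 → ℝ) (x : Fin n → ℝ) :
    (Matrix.of fun i => grad ((rowTerm n F i).relabel (Sum.map Empty.elim _root_.id)) β x) =
      jac n F x := by
  ext i j
  rw [Matrix.of_apply, grad_apply, realize_termPDeriv_relabel_params', Sum.elim_comp_map,
    Function.comp_id, show β ∘ Empty.elim = (Empty.elim : Empty → ℝ) from funext fun e => e.elim]
  rfl

/-- **The non-singular zeros of the system lie in Wilkie's non-singular zero set `Vⁿˢ` of its row
terms** (common zeros with linearly independent gradient rows: the Jacobian determinant, which is
the determinant of the Fréchet derivative by `det_fderiv_sysMap`, is non-zero). [cite: Wilkie1989, §5, p. 402] -/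
theorem setOf_isNonsingularZero_subset_realNonsingularZeroSet (β : Fin 0 → ℝ) :
    {a : Fin n → ℝ | IsNonsingularZero n F a} ⊆
      realNonsingularZeroSet (fun i => (rowTerm n F i).relabel (Sum.map Empty.elim _root_.id)) β := by
  rintro a ⟨hlen, hzero, hdet⟩
  refine ⟨fun r => ?_, ?_⟩
  · rw [realize_rowTerm_relabel]
    exact congrFun hzero r
  · rw [linearIndependent_rows_iff_det_ne_zero]
    have key : (Matrix.of fun i =>
        grad ((rowTerm n F i).relabel (Sum.map Empty.elim _root_.id)) β a).det ≠ 0 := by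
      rw [of_grad_rowTerm_relabel, ← det_fderiv_sysMap]
      exact hdet
    exact key

/-- **An `n × n` system of exponential polynomials over `ℤ` has only finitely many non-singular
real zeros** — Khovanskii's finiteness theorem (proved in the tree for square systems of
`L_exp`-terms, `RealExpModel.exists_forall_encard_realNonsingularZeroSet_le`), the remark of
Berarducci–Servi after the statement of the Last Root Conjecture. [cite: BerarducciServi2004, p. 44] [cite: Khovanskii1991, Ch. III] -/
theorem finite_setOf_isNonsingularZero : {a : Fin n → ℝ | IsNonsingularZero n F a}.Finite := by
  obtain ⟨N, hN⟩ := exists_forall_encard_realNonsingularZeroSet_le (m := 0)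
    fun i => (rowTerm n F i).relabel (Sum.map Empty.elim _root_.id)
  exact (Set.finite_of_encard_le_coe (hN fun _ => 0)).subset
    (setOf_isNonsingularZero_subset_realNonsingularZeroSet n F fun _ => 0)

/-- **The Last Root Conjecture without effectivity, unconditionally**: every `n × n` system of
exponential polynomials over `ℤ` has a bound `η ∈ ℕ` on the sup norm of its non-singular real
zeros (a finite set is bounded); compare `exists_bound_isNonsingularZero` of
`LastRootConjectureProofs.lean`, which assumed the o-minimality of `ℝ_exp`. [cite: BerarducciServi2004, p. 44] -/
theorem exists_bound_isNonsingularZero' :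
    ∃ η : ℕ, ∀ a : Fin n → ℝ, IsNonsingularZero n F a → ‖a‖ < η := by
  obtain ⟨R, hR⟩ := ((finite_setOf_isNonsingularZero n F).image fun a => ‖a‖).bddAbove
  refine ⟨⌊R⌋₊ + 1, fun a ha => ?_⟩
  have h : ‖a‖ ≤ R := hR ⟨a, ha, rfl⟩
  calc ‖a‖ ≤ R := h
    _ < ⌊R⌋₊ + 1 := Nat.lt_floor_add_one R
    _ = ((⌊R⌋₊ + 1 : ℕ) : ℝ) := by push_cast; ring

/-- Hence for every system some bounding sentence `σ_{F,η}` is true in `ℝ_exp`, unconditionally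
(compare `exists_realize_sigma`). [folklore] -/
theorem exists_realize_sigma' : ∃ η : ℕ, ℝ ⊨ sigma n F η := by
  obtain ⟨η, hη⟩ := exists_bound_isNonsingularZero' n (pad n F)
  refine ⟨η, realize_sigma_iff.2 fun a ha i => ?_⟩
  have h := hη a ha
  have hi : |a i| ≤ ‖a‖ := by simpa [Real.norm_eq_abs] using norm_le_pi_norm a i
  exact hi.trans h.le

end Rows

/-! ### The search, unconditionally -/

/-- **Decidability of `Th(ℝ_exp)` gives a computable bound on the non-singular zeros of every
`n × n` system, unconditionally**: search, with the decision procedure, for the least `η` such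
that `σ_{F,η}` is true — the search of `exists_computable_bound_of_isDecidable`
(`LastRootConjectureOfDecidable.lean`), its termination now guaranteed by Khovanskii's theorem
instead of o-minimality. [cite: BerarducciServi2004, p. 44] -/
theorem exists_computable_bound_of_isDecidable' (hD : realExpTheory.IsDecidable) :
    ∃ η : ℕ × List ExpPolyCode → ℕ, Computable η ∧
      ∀ (n : ℕ) (F : List ExpPolyCode) (a : Fin n → ℝ), IsNonsingularZero n F a → ‖a‖ < η (n, F) := by
  obtain ⟨d, hd, hd_iff⟩ := exists_truth_decider hD
  have hL : Primrec fun q : (ℕ × List ExpPolyCode) × ℕ => sigmaL q.1.1 q.1.2 q.2 :=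
    primrec_sigmaL.comp (Primrec.pair (Primrec.fst.comp Primrec.fst)
      (Primrec.pair (Primrec.snd.comp Primrec.fst) Primrec.snd))
  have htest : Computable₂ fun (p : ℕ × List ExpPolyCode) (η : ℕ) => d (encode (sigmaL p.1 p.2 η)) :=
    hd.comp (Primrec.encode.comp hL).to_comp
  have htest_iff : ∀ (p : ℕ × List ExpPolyCode) (η : ℕ),
      d (encode (sigmaL p.1 p.2 η)) = true ↔ ℝ ⊨ sigma p.1 p.2 η := fun p η => by
    rw [← godelNumber_sigma]; exact hd_iff _
  obtain ⟨f, hf, hf_spec⟩ := exists_computable_search htest fun p =>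
    (exists_realize_sigma' p.1 p.2).imp fun η hη => (htest_iff p η).2 hη
  refine ⟨fun p => f p + 1, Computable.succ.comp hf, fun n F a ha => ?_⟩
  have h := norm_lt_of_realize_sigma ((htest_iff (n, F) _).1 (hf_spec (n, F))) ha
  push_cast
  exact h

end ExpPolyCode

/-! ### The direction `→` unconditionally, and the equivalence from effective model completeness -/

/-- **Macintyre–Wilkie's equivalence, direction `→`, unconditionally**: if `Th(ℝ_exp)` is
decidable then the Last Root Conjecture holds — a computable bound on the non-singular zeros of
`n × n` exponential systems is obtained by searching, with the decision procedure, for a true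
bounding sentence `σ_{F,η}`, which exists by Khovanskii's finiteness theorem (Berarducci–Servi
2004, p. 44, reporting Macintyre–Wilkie 1996).  Supersedes
`lastRootConjecture_of_realExpDecidable (hO : wilkie_isOMinimal)`. [cite: BerarducciServi2004, p. 44] [cite: MacintyreWilkieKreiseliana1996] -/
theorem lastRootConjecture_of_realExpDecidable' (hD : RealExpDecidable) : LastRootConjecture :=
  ExpPolyCode.exists_computable_bound_of_isDecidable' hD

/-- Hence Macintyre–Wilkie's Thm. 1.1 (`Literature.ModelTheory.ExponentialFields.macintyre_wilkie`)
makes the real Schanuel property imply the Last Root Conjecture, with no o-minimality hypothesis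
(compare `lastRootConjecture_of_schanuelProperty_of_wilkie_isOMinimal`). [cite: MacintyreWilkieKreiseliana1996, Thm. 1.1] -/
theorem lastRootConjecture_of_macintyre_wilkie (hMW : macintyre_wilkie) (hS : SchanuelProperty ℝ) :
    LastRootConjecture :=
  lastRootConjecture_of_realExpDecidable' (hMW hS)

/-- A decidable `Th(ℝ_exp)` is its own recursive subtheory: decidability trivially gives
Macintyre–Wilkie's effective model completeness statement `macintyreWilkie_recursiveSubtheory`
(with `T₀ = Th(ℝ_exp)`, `realExpDecidable_iff_isRecursive`). [folklore] -/
theorem macintyreWilkie_recursiveSubtheory_of_realExpDecidable (hD : RealExpDecidable) :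
    macintyreWilkie_recursiveSubtheory :=
  ⟨realExpTheory, subset_rfl, realExpDecidable_iff_isRecursive.1 hD, fun _ hφ =>
    Language.Theory.models_sentence_mono Set.subset_union_left
      (Language.Theory.models_sentence_of_mem hφ)⟩

/-- **Macintyre–Wilkie's equivalence `RealExpDecidable ↔ LastRootConjecture` from their effective
model completeness alone**: granted a recursive `T₀ ⊆ Th(ℝ_exp)` with
`T₀ ∪ Th_∃(ℝ_exp) ⊨ Th(ℝ_exp)` (`macintyreWilkie_recursiveSubtheory`, the unconditional half of
Macintyre–Wilkie's paper, p. 448), decidability of `Th(ℝ_exp)` is equivalent to the Last Root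
Conjecture: `→` is `lastRootConjecture_of_realExpDecidable'` (unconditional), `←` is
`realExpDecidable_of_lastRootConjecture_of_recursiveSubtheory` (the Last Root Conjecture makes
`Th_∃(ℝ_exp)` recursively enumerable, unconditionally; with `T₀` this axiomatizes the complete
theory).  Supersedes `macintyreWilkie_realExpDecidable_iff_lastRootConjecture_of_facts`, which
also assumed `wilkie_isOMinimal`. [cite: MacintyreWilkieKreiseliana1996] [cite: BerarducciServi2004, p. 44] -/
theorem macintyreWilkie_realExpDecidable_iff_lastRootConjecture_of_recursiveSubtheory
    (hA : macintyreWilkie_recursiveSubtheory) :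
    macintyreWilkie_realExpDecidable_iff_lastRootConjecture :=
  ⟨lastRootConjecture_of_realExpDecidable', realExpDecidable_of_lastRootConjecture_of_recursiveSubtheory hA⟩

/-- **What remains of the named equivalence.** `macintyreWilkie_realExpDecidable_iff_lastRootConjecture`
is *equivalent* to the implication "Last Root Conjecture ⇒ effective model completeness
(`macintyreWilkie_recursiveSubtheory`)": the direction `→` of the equivalence and the step
"Last Root Conjecture ⇒ `Th_∃(ℝ_exp)` is r.e." being theorems, the named fact holds as soon as (and
only if) the Last Root Conjecture yields a recursive `T₀ ⊆ Th(ℝ_exp)` with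
`T₀ ∪ Th_∃(ℝ_exp) ⊨ Th(ℝ_exp)` — in Macintyre–Wilkie's paper `T₀` is constructed outright. [cite: MacintyreWilkieKreiseliana1996] -/
theorem macintyreWilkie_realExpDecidable_iff_lastRootConjecture_iff :
    macintyreWilkie_realExpDecidable_iff_lastRootConjecture ↔
      (LastRootConjecture → macintyreWilkie_recursiveSubtheory) :=
  ⟨fun h hL => macintyreWilkie_recursiveSubtheory_of_realExpDecidable (h.2 hL),
    fun h => ⟨lastRootConjecture_of_realExpDecidable', fun hL =>
      realExpDecidable_of_lastRootConjecture_of_recursiveSubtheory (h hL) hL⟩⟩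

/-- Likewise, granted effective model completeness, Macintyre–Wilkie's Thm. 1.1
(`Literature.ModelTheory.ExponentialFields.macintyre_wilkie`) is equivalent to "the real Schanuel
property implies the Last Root Conjecture" (compare
`macintyre_wilkie_iff_lastRootConjecture_of_schanuelProperty_of_facts`). [cite: MacintyreWilkieKreiseliana1996, Thm. 1.1] -/
theorem macintyre_wilkie_iff_lastRootConjecture_of_schanuelProperty_of_recursiveSubtheory
    (hA : macintyreWilkie_recursiveSubtheory) :
    macintyre_wilkie ↔ (SchanuelProperty ℝ → LastRootConjecture) :=
  macintyre_wilkie_iff_lastRootConjecture_of_schanuelProperty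
    (macintyreWilkie_realExpDecidable_iff_lastRootConjecture_of_recursiveSubtheory hA)

end Literature.ModelTheory.ExponentialFields

end
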